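import Summits.HubbardSuperconductivity.HubbardSuperconductivity.Theorems.AnisotropyChordTowerLadder

/-!
# Route `AnisotropyChord` / H0 rotor rung: THE TOTAL-SPIN TRANSFER — tower asymmetry = total-spin increment, the
# XY-analogue of Lieb–Mattis ordering (FIRST LEMMA OF RECORD XY-LM₀, OPEN) and the CONDITIONAL RECORD RUNG
# «XY-LM₀ ∧ half-filling anchor ⇒ condensation on a density band» (port of theory seat `hubbard-h0-rotor-theory-1`,
# cycle 11, `Sketch11.lean` Part D, memo ROTOR-THEORY-11 §151–§152; work-order v11b; director ruling 2026-08-28T13:48:19Z (a),(b))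

* `totalSpinSq a M = ‖S⁻_tot a‖² + M² − M` (`⟨S⃗²_tot⟩` in sector `M`); EXACT IDENTITY `lowerNormSq_sub_raiseNormSq_eq`
  (`‖S⁻ a‖² − ‖S⁺ b‖² = ⟨S⃗²⟩_a(M+1) − ⟨S⃗²⟩_b(M)`), `towerFidelity_le_removalFidelity_iff`;
* TYPED, OPEN: **`MinSpinAtZero Δ`** (XY-LM₀), **`TotalSpinMonotone Δ`** (XY-LM), `MinSpinAtZeroUpTo Δ ε`; hypothesis class
  delimited by the theory seat's census (kit j309700: FALSE on generic graphs — 22705/23673 non-bipartite V = 6 graphs at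
  Δ = 0, stars K_{1,n≥3} at every Δ; holds on every tested homogeneous family, 404 tower links on 4×4…8×8, 0 violations);
* support `PerronZeroOfInt Δ` (typed; PROVED for every Δ in `…TowerPerronZero` of this work-order), targets `CondensateOnBand`;
* **PROVED implications** `condensateOnBand_of_minSpinAtZero`, `…_of_totalSpinMonotone`, `…_of_minSpinAtZeroUpTo`
  (floor `c₀/2 − ε` on the band `|M| ≤ min(c₀/4, 1/4)|V|`).  At `Δ = 0` the anchor is Kennedy–Lieb–Shastry: XY-LM₀ alone
  would give BEC for hard-core bosons on `ℤ²` near half filling (Tasaki arXiv:1807.05847 p. 7 §3.2: expected, open).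
Print status of XY-LM₀: «first lemma, under audit» (hubbard-pc-critic-3).  Typing/proof authority: theory seat.
-/

set_option linter.dupNamespace false
set_option autoImplicit false

noncomputable section

open Finset Filter Topology
open Summit.HubbardSuperconductivity.HubbardSuperconductivity.Theorems.AnisotropyChord.InsertionEntropy
open Literature.MathematicalPhysics.QuantumLattice Literature.Probability.LatticeModels

namespace Summit.HubbardSuperconductivity.HubbardSuperconductivity.Theorems.AnisotropyChord.Tower

/-! ## Part D — THE TOTAL-SPIN REFORMULATION (cycle 11, second half).

EXACT IDENTITY.  For unit amplitudes `b` (sector `Sᶻ = M`, i.e. `|V|/2 + M` particles) and `a` (sector `M+1`):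
`‖S⁻_tot a‖² − ‖S⁺_tot b‖² = ⟨S⃗²⟩_a − ⟨S⃗²⟩_b`, where `⟨S⃗²⟩_ψ = ‖S⁻ψ‖² + M² − M` (`S⃗² = S⁺S⁻ + (Sᶻ)² − Sᶻ`).
So the one-step tower asymmetry `D(M) = Λ↓(M+1) − Λ↑(M)` of Part A is the INCREMENT OF THE EXPECTED TOTAL SPIN
between adjacent sector ground states, and `Z₊(M) ≤ Z₋(M+1)` («removal beats addition») `⇔ ⟨S⃗²⟩_{M+1} ≤ ⟨S⃗²⟩_M`.
Consequently NO LADDER IS NEEDED: `‖S⁻ψ_M‖² = ⟨S⃗²⟩_M − M² + M ≥ ⟨S⃗²⟩_0 − M² + M = ‖S⁻ψ_0‖² − M² + M` as soon as the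
`Sᶻ = 0` ground state MINIMISES `⟨S⃗²_tot⟩` among sector ground states — an XY-analogue of Lieb–Mattis ordering
(for the antiferromagnet the sector-`M` ground state has `S = |M|`, monotone in `|M|`; here `S⃗²` is not conserved
and the statement is about expectations).  KLS at half filling then gives condensation on the band `|M| ≤ δ|V|`. -/

section Spin

variable {V : Type} [Fintype V] [DecidableEq V]

/-- `⟨S⃗²_tot⟩` of a real unit amplitude `a` in the sector `Sᶻ_tot = M`:  `‖S⁻_tot a‖² + M² − M`
(`S⃗² = S⁺S⁻ + (Sᶻ)² − Sᶻ`, `‖S⁻_tot a‖² = lowerNormSq a`; particles = up spins, `M = N − |V|/2`). [folklore] -/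
def totalSpinSq (a : (V → Fin 2) → ℝ) (M : ℝ) : ℝ := lowerNormSq a + M ^ 2 - M

/-- **EXACT IDENTITY (tower asymmetry = total-spin increment).**  For a unit amplitude `b` supported on
`n`-particle configurations (`M = n − |V|/2`) and any `a` (read in sector `M + 1`):
`‖S⁻ a‖² − ‖S⁺ b‖² = ⟨S⃗²⟩_a(M+1) − ⟨S⃗²⟩_b(M)`. [folklore] -/
theorem lowerNormSq_sub_raiseNormSq_eq (b a : (V → Fin 2) → ℝ) (n : ℝ) (hunit : ∑ ν, b ν ^ 2 = 1)
    (hsupp : ∀ ν, b ν ≠ 0 → ((univ.filter fun x => ν x = 0).card : ℝ) = n) :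
    lowerNormSq a - raiseNormSq b
      = totalSpinSq a (n - (Fintype.card V : ℝ) / 2 + 1) - totalSpinSq b (n - (Fintype.card V : ℝ) / 2) := by
  rw [raiseNormSq_eq_lowerNormSq_add b n hsupp, hunit]
  unfold totalSpinSq
  ring

/-- «Removal beats addition» `Z₊(b → a) ≤ Z₋(a → b)` is equivalent to `‖S⁻ a‖² ≤ ‖S⁺ b‖²` whenever the common
numerator `⟨a, S⁺ b⟩²` is non-zero (both fidelities share it). [folklore] -/
theorem towerFidelity_le_removalFidelity_iff (b a : (V → Fin 2) → ℝ) (hnum : towerSum b a ≠ 0)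
    (hup : 0 < raiseNormSq b) (hdn : 0 < lowerNormSq a) :
    towerFidelity b a ≤ removalFidelity b a ↔ lowerNormSq a ≤ raiseNormSq b := by
  unfold towerFidelity removalFidelity
  rw [towerSum_eq_raise] at hnum ⊢
  have h2 : 0 < (∑ σ, raiseSum b σ * a σ) ^ 2 := by positivity
  rw [div_le_div_iff₀ hup hdn]
  constructor
  · intro h; nlinarith
  · intro h; nlinarith

/-- **HYPOTHESIS XY-LM₀ (min-spin at half filling; OPEN, conjectured for the easy-plane ferromagnetic XXZ model on
any connected graph with non-negative hoppings):** the `Sᶻ_tot = 0` sector ground state minimises `⟨S⃗²_tot⟩` among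
all sector ground states.  Census: all connected graphs `|V| ≤ 6` × `Δ ∈ {−1,0,1,1.9,3}`, random graphs `|V| ≤ 9`,
lattices/tori up to 36 sites (kit j309581, j309316/j309580; memo ROTOR-THEORY-11 §152).
[conjecture: theory seat hubbard-h0-rotor-theory-1, cycle 11 — XY-analogue of Lieb–Mattis ordering; OPEN] -/
def MinSpinAtZero (Δ : ℝ) : Prop :=
  ∀ (L : ℕ) [NeZero L] (M : ℝ) (a₀ a : TensorIndex (TorusSite 2 L) 2 → ℝ),
    IsPerronSectorGroundAmplitude L Δ 0 a₀ → IsPerronSectorGroundAmplitude L Δ M a →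
      totalSpinSq a₀ 0 ≤ totalSpinSq a M

/-- **HYPOTHESIS XY-LM (monotone form; OPEN):** `|M| ≤ |M'| ⇒ ⟨S⃗²⟩_{ψ_M} ≤ ⟨S⃗²⟩_{ψ_{M'}}` for sector ground
states — equivalently (Part D identity) `Z₊(M) ≤ Z₋(M+1)` below and `≥` above half filling.
[conjecture: theory seat hubbard-h0-rotor-theory-1, cycle 11 — XY-analogue of Lieb–Mattis ordering; OPEN] -/
def TotalSpinMonotone (Δ : ℝ) : Prop :=
  ∀ (L : ℕ) [NeZero L] (M M' : ℝ) (a a' : TensorIndex (TorusSite 2 L) 2 → ℝ),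
    IsPerronSectorGroundAmplitude L Δ M a → IsPerronSectorGroundAmplitude L Δ M' a' → |M| ≤ |M'| →
      totalSpinSq a M ≤ totalSpinSq a' M'

/-- XY-LM ⇒ XY-LM₀. [folklore] -/
theorem minSpinAtZero_of_totalSpinMonotone (Δ : ℝ) (h : TotalSpinMonotone Δ) : MinSpinAtZero Δ := by
  intro L _ M a₀ a h₀ ha
  exact h L 0 M a₀ a h₀ ha (by rw [abs_zero]; exact abs_nonneg M)

/-- SUPPORT STATEMENT (provable; port): if an INTEGER sector `M` carries a Perron ground amplitude then `|V|` is even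
and the sector `0` carries one (Perron–Frobenius on the connected half-filling sector graph).
[conjecture: theory seat hubbard-h0-rotor-theory-1, cycle 11 — support statement (provable)] -/
def PerronZeroOfInt (Δ : ℝ) : Prop :=
  ∀ (L : ℕ) [NeZero L] (M : ℤ) (a : TensorIndex (TorusSite 2 L) 2 → ℝ),
    IsPerronSectorGroundAmplitude L Δ (M : ℝ) a →
      ∃ a₀ : TensorIndex (TorusSite 2 L) 2 → ℝ, IsPerronSectorGroundAmplitude L Δ 0 a₀

/-- Conclusion shape: condensation with floor `c` on the two-sided magnetisation band `|Sᶻ_tot| ≤ δ|V|`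
(densities `|ρ − 1/2| ≤ δ`), integer sectors.
[conjecture: theory seat hubbard-h0-rotor-theory-1, cycle 11 — target-side statement] -/
def CondensateOnBand (Δ δ c : ℝ) : Prop :=
  ∀ᶠ L : ℕ in atTop, ∀ [NeZero L], ∀ M : ℤ, |(M : ℝ)| ≤ δ * (Fintype.card (TorusSite 2 L) : ℝ) →
    ∀ a : TensorIndex (TorusSite 2 L) 2 → ℝ,
      IsPerronSectorGroundAmplitude L Δ (M : ℝ) a → c ≤ condensateDensity a

/-- **THEOREM (min-spin transfer of condensation off half filling).**  `XY-LM₀ ∧` half-filling anchor `c₀`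
`⇒` condensate density `≥ c₀/2` on the band `|M| ≤ min(c₀/4, 1/4)·|V|`, via
`|V|²·ρ_c(ψ_M) = ‖S⁻ψ_M‖² = ⟨S⃗²⟩_M − M² + M ≥ ⟨S⃗²⟩_0 − M² − |M| ≥ c₀|V|² − δ²|V|² − δ|V|`.
At `Δ = 0` the anchor is Kennedy–Lieb–Shastry 1988, so XY-LM₀ ALONE would give BEC for hard-core bosons on `ℤ²`
at every filling `|ρ − 1/2| ≤ min(c₀/4, 1/4)` — no stiffness, no compressibility, no ladder.
[conjecture: theory seat hubbard-h0-rotor-theory-1, cycle 11, memo ROTOR-THEORY-11 §151 (the implication is proved here)] -/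
theorem condensateOnBand_of_minSpinAtZero (Δ c₀ : ℝ) (hc₀ : 0 < c₀) (hmin : MinSpinAtZero Δ)
    (hZ : PerronZeroOfInt Δ) (hA : HalfFillingAnchor Δ c₀) :
    CondensateOnBand Δ (min (c₀ / 4) (1 / 4)) (c₀ / 2) := by
  filter_upwards [hA] with L hAL
  intro _ M hM a ha
  set W := (Fintype.card (TorusSite 2 L) : ℝ) with hWdef
  have hW : W = (L : ℝ) ^ 2 := by
    rw [hWdef, Fintype.card_fun, ZMod.card, Fintype.card_fin]; push_cast; ring
  have hL1 : (1 : ℝ) ≤ L := by exact_mod_cast Nat.one_le_iff_ne_zero.mpr (NeZero.ne L)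
  have hW1 : 1 ≤ W := by rw [hW]; nlinarith
  have hWpos : 0 < W := by linarith
  obtain ⟨a₀, h₀⟩ := hZ L M a ha
  have hanchor : c₀ * W ^ 2 ≤ lowerNormSq a₀ := by
    have h := hAL a₀ h₀
    have : condensateDensity a₀ = lowerNormSq a₀ / W ^ 2 := rfl
    rw [this, le_div_iff₀ (by positivity)] at h
    exact h
  have hspin := hmin L (M : ℝ) a₀ a h₀ ha
  unfold totalSpinSq at hspin
  set δ := min (c₀ / 4) (1 / 4) with hδdef
  have hδc : δ ≤ c₀ / 4 := min_le_left _ _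
  have hδ4 : δ ≤ 1 / 4 := min_le_right _ _
  have hδ0 : 0 ≤ δ := by positivity
  have hMabs : |(M : ℝ)| ≤ δ * W := hM
  have hM2 : (M : ℝ) ^ 2 ≤ (δ * W) ^ 2 := by
    rw [← sq_abs]; exact pow_le_pow_left₀ (abs_nonneg _) hMabs 2
  have hM1 : -(M : ℝ) ≤ δ * W := le_trans (neg_le_abs _) hMabs
  have hlow : c₀ * W ^ 2 - (δ * W) ^ 2 - δ * W ≤ lowerNormSq a := by nlinarith
  have hgoal : c₀ / 2 * W ^ 2 ≤ lowerNormSq a := by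
    have h1 : (δ * W) ^ 2 + δ * W ≤ (5 * c₀ / 16) * W ^ 2 := by
      have e1 : δ ^ 2 ≤ δ / 4 := by nlinarith [hδ4, hδ0]
      have e2 : δ ^ 2 * W ^ 2 ≤ δ / 4 * W ^ 2 := mul_le_mul_of_nonneg_right e1 (by positivity)
      have e3 : δ * W ≤ δ * W ^ 2 := by
        calc δ * W = δ * W * 1 := by ring
          _ ≤ δ * W * W := mul_le_mul_of_nonneg_left hW1 (by positivity)
          _ = δ * W ^ 2 := by ring
      have e4 : δ / 4 * W ^ 2 + δ * W ^ 2 ≤ (5 * c₀ / 16) * W ^ 2 := by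
        have : δ / 4 + δ ≤ 5 * c₀ / 16 := by linarith
        nlinarith [this, sq_nonneg W]
      calc (δ * W) ^ 2 + δ * W = δ ^ 2 * W ^ 2 + δ * W := by ring
        _ ≤ δ / 4 * W ^ 2 + δ * W ^ 2 := by linarith
        _ ≤ (5 * c₀ / 16) * W ^ 2 := e4
    nlinarith
  have : condensateDensity a = lowerNormSq a / W ^ 2 := rfl
  rw [this, le_div_iff₀ (by positivity)]
  exact hgoal

/-- Monotone form ⇒ the same conclusion. -/
theorem condensateOnBand_of_totalSpinMonotone (Δ c₀ : ℝ) (hc₀ : 0 < c₀) (hmono : TotalSpinMonotone Δ)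
    (hZ : PerronZeroOfInt Δ) (hA : HalfFillingAnchor Δ c₀) :
    CondensateOnBand Δ (min (c₀ / 4) (1 / 4)) (c₀ / 2) :=
  condensateOnBand_of_minSpinAtZero Δ c₀ hc₀ (minSpinAtZero_of_totalSpinMonotone Δ hmono) hZ hA

/-- **HYPOTHESIS XY-LM₀(ε) (asymptotic, refutation-robust form):** eventually in `L`, the `Sᶻ = 0` sector ground
state minimises `⟨S⃗²_tot⟩` among sector ground states UP TO `ε|V|²`.  Implied (heuristically, with room) by
«the condensate fraction `λ_L(ρ)` is asymptotically minimal at half filling», since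
`⟨S⃗²⟩_M − ⟨S⃗²⟩_0 ≈ [λ(ρ) − λ(½)]|V|²/4 + (1 − λ(ρ))M²`.
[conjecture: theory seat hubbard-h0-rotor-theory-1, cycle 11 — asymptotic XY-Lieb–Mattis; OPEN] -/
def MinSpinAtZeroUpTo (Δ ε : ℝ) : Prop :=
  ∀ᶠ L : ℕ in atTop, ∀ [NeZero L], ∀ (M : ℝ) (a₀ a : TensorIndex (TorusSite 2 L) 2 → ℝ),
    IsPerronSectorGroundAmplitude L Δ 0 a₀ → IsPerronSectorGroundAmplitude L Δ M a →
      totalSpinSq a₀ 0 ≤ totalSpinSq a M + ε * (Fintype.card (TorusSite 2 L) : ℝ) ^ 2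

/-- XY-LM₀ ⇒ XY-LM₀(0). [folklore] -/
theorem minSpinAtZeroUpTo_of_exact (Δ : ℝ) (h : MinSpinAtZero Δ) : MinSpinAtZeroUpTo Δ 0 :=
  Filter.Eventually.of_forall fun L _ M a₀ a h₀ ha => by
    have := h L M a₀ a h₀ ha; linarith

/-- **THEOREM (robust form).** `XY-LM₀(ε) ∧` anchor `c₀` `⇒` floor `c₀/2 − ε` on the band `|M| ≤ min(c₀/4,1/4)|V|`. -/
theorem condensateOnBand_of_minSpinAtZeroUpTo (Δ c₀ ε : ℝ) (hc₀ : 0 < c₀) (hmin : MinSpinAtZeroUpTo Δ ε)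
    (hZ : PerronZeroOfInt Δ) (hA : HalfFillingAnchor Δ c₀) :
    CondensateOnBand Δ (min (c₀ / 4) (1 / 4)) (c₀ / 2 - ε) := by
  filter_upwards [hA, hmin] with L hAL hminL
  intro _ M hM a ha
  set W := (Fintype.card (TorusSite 2 L) : ℝ) with hWdef
  have hW : W = (L : ℝ) ^ 2 := by
    rw [hWdef, Fintype.card_fun, ZMod.card, Fintype.card_fin]; push_cast; ring
  have hL1 : (1 : ℝ) ≤ L := by exact_mod_cast Nat.one_le_iff_ne_zero.mpr (NeZero.ne L)
  have hW1 : 1 ≤ W := by rw [hW]; nlinarith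
  have hWpos : 0 < W := by linarith
  obtain ⟨a₀, h₀⟩ := hZ L M a ha
  have hanchor : c₀ * W ^ 2 ≤ lowerNormSq a₀ := by
    have h := hAL a₀ h₀
    have : condensateDensity a₀ = lowerNormSq a₀ / W ^ 2 := rfl
    rw [this, le_div_iff₀ (by positivity)] at h
    exact h
  have hspin := hminL (M : ℝ) a₀ a h₀ ha
  unfold totalSpinSq at hspin
  set δ := min (c₀ / 4) (1 / 4) with hδdef
  have hδc : δ ≤ c₀ / 4 := min_le_left _ _
  have hδ4 : δ ≤ 1 / 4 := min_le_right _ _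
  have hδ0 : 0 ≤ δ := by positivity
  have hMabs : |(M : ℝ)| ≤ δ * W := hM
  have hM2 : (M : ℝ) ^ 2 ≤ (δ * W) ^ 2 := by
    rw [← sq_abs]; exact pow_le_pow_left₀ (abs_nonneg _) hMabs 2
  have hM1 : -(M : ℝ) ≤ δ * W := le_trans (neg_le_abs _) hMabs
  have hlow : c₀ * W ^ 2 - (δ * W) ^ 2 - δ * W - ε * W ^ 2 ≤ lowerNormSq a := by nlinarith
  have hgoal : (c₀ / 2 - ε) * W ^ 2 ≤ lowerNormSq a := by
    have h1 : (δ * W) ^ 2 + δ * W ≤ (5 * c₀ / 16) * W ^ 2 := by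
      have e1 : δ ^ 2 ≤ δ / 4 := by nlinarith [hδ4, hδ0]
      have e2 : δ ^ 2 * W ^ 2 ≤ δ / 4 * W ^ 2 := mul_le_mul_of_nonneg_right e1 (by positivity)
      have e3 : δ * W ≤ δ * W ^ 2 := by
        calc δ * W = δ * W * 1 := by ring
          _ ≤ δ * W * W := mul_le_mul_of_nonneg_left hW1 (by positivity)
          _ = δ * W ^ 2 := by ring
      have e4 : δ / 4 * W ^ 2 + δ * W ^ 2 ≤ (5 * c₀ / 16) * W ^ 2 := by
        have : δ / 4 + δ ≤ 5 * c₀ / 16 := by linarith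
        nlinarith [this, sq_nonneg W]
      calc (δ * W) ^ 2 + δ * W = δ ^ 2 * W ^ 2 + δ * W := by ring
        _ ≤ δ / 4 * W ^ 2 + δ * W ^ 2 := by linarith
        _ ≤ (5 * c₀ / 16) * W ^ 2 := e4
    nlinarith
  have : condensateDensity a = lowerNormSq a / W ^ 2 := rfl
  rw [this, le_div_iff₀ (by positivity)]
  exact hgoal

end Spin

end Summit.HubbardSuperconductivity.HubbardSuperconductivity.Theorems.AnisotropyChord.Tower
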